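import Summits.ResolutionOfSingularities.ResolutionOfSingularities.Theorems.FrobeniusClosingSteerToricVertexPerron
import HarnessLib

/-!
# Crux `Steer` (stmt-ResolutionOfSingularities-16345) — TORIC EXIT AT A DOMINANT VERTEX, part 3: odd-support reduction, the Jacobian
# chart `∂/∂Z_a`, and the GENERAL THEOREM `concl_of_dominant_monomial` (any characteristic, any number of letters and monomials)

OURS (campaign res-hironaka, rung L ★L-G4, slot W4.1; res-D-brk-2 g6 on res-L0-w41-plan-1 RULING 229 (d), E-ROW #3; signature file
`D/res-D-brk-2/K_W9_signature.lean` 40590a5e08b7c948, theorem `concl_of_dominant_monomial` VERBATIM). Candidates, not facts; NOT a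
statement of H. Hironaka's manuscript [claim: Hironaka2017, status: under-review]; AI formalisation, weaker than expert review;
`--supports stmt-ResolutionOfSingularities-16345`, counted 0. Definition-free.

## What is proved (fields `k ⊆ K`, valuation subring `O ⊇ k` of `K`)

* `exists_relettering_single_odd` (`§1`) — an `ℕ`-vector `p` with SOME odd coordinate becomes, after an admissible re-lettering
  (parts 1–2), a vector with EXACTLY ONE odd coordinate (pair blow-ups inside the odd support: `p'_a = p_a + p_b` is even).
* `concl_of_single_odd_chart` (`§2`) — THE JACOBIAN CHART: letters `z : Fin n → K` in `O ∖ 0`, `t₁ ∈ K` with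
  `t₁² = c₀ · z_a · U(z)` (`c₀ ∈ kˣ`, `U ∈ k[Z]` with `v(U(z) − 1) < 1` and `v(z_a · (∂U/∂Z_a)(z)) < 1`), `k(z, t₁) = K`, `trdeg_k K = n`:
  the hypersurface `G = T² − c₀ Z_a U` has `∂G/∂Z_a (z, t₁) = −c₀ (U(z) + z_a ∂_aU(z))` of value `1`, so (E2)
  `SteerToricExitCriterion.concl_of_jacobianUnit` gives `Concl O A₀ t` for every finitely generated `A₀ ≤ k[z]` and `t ∈ k[z, t₁]`.
* **`concl_of_dominant_monomial`** (`§3`) — if `t² = Σ_{i ≤ m} c_i y^{E_i}` with letters `y_j ∈ O ∖ 0`, `c_0 ≠ 0`, the vertex `E_0`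
  having SOME ODD exponent and being STRICTLY ν-DOMINANT along `O` (`O.valuation y^{E_i} < O.valuation y^{E_0}` for `i ≠ 0`), and
  `k(y, t) = K`, `trdeg_k K = n`, then `Concl O k[y] t`. Proof: Perron-monomialise the ratios `y^{E_i − E_0}` (part 2), reduce the odd
  support of the vertex exponent to one letter `z_a` (`§1`), put `t₁ = t / z^{⌊p/2⌋}`, `U = 1 + Σ (c_i/c_0)·Z^{g_i}`, and use `§2`
  (`Z_a ∂_a Z^{g} = g_a · Z^{g}`, so `z_a ∂_aU(z)` is a sum of multiples of the ratios, all of value `< 1`).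
No characteristic hypothesis anywhere. [cite: Teissier2014] [cite: Matsumura1987, Thm. 30.3] [folklore]
-/

noncomputable section

-- single-problem summit: the doubled namespace component `ResolutionOfSingularities` is forced
set_option linter.dupNamespace false

open scoped BigOperators

namespace Summit.ResolutionOfSingularities.ResolutionOfSingularities.Theorems.SteerToricVertexExit

open Summit.ResolutionOfSingularities.ResolutionOfSingularities.Theorems.SteerToricVertexSplit
open Literature.AlgebraicGeometry.Resolution
open MvPolynomial

variable {k K : Type} [Field k] [Field K] [Algebra k K]

/-! ## §1 Reduction of the odd support to one letter -/

section OddSupport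

variable {n : ℕ}

/-- A pair blow-up with both pivot letters odd lowers the number of odd letters by one. [folklore] -/
private theorem card_odd_update_lt (p : Fin n → ℤ) {a b : Fin n} (hab : a ≠ b) (ha : Odd (p a)) (hb : Odd (p b)) :
    (Finset.univ.filter fun j => Odd (Function.update p a (p a + p b) j)).card <
      (Finset.univ.filter fun j => Odd (p j)).card := by
  classical
  have hsub : (Finset.univ.filter fun j => Odd (Function.update p a (p a + p b) j)) ⊆
      (Finset.univ.filter fun j => Odd (p j)).erase a := by
    intro j hj
    simp only [Finset.mem_filter, Finset.mem_univ, true_and] at hj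
    have hja : j ≠ a := by
      rintro rfl
      rw [Function.update_self] at hj
      exact (Int.not_odd_iff_even.mpr (ha.add_odd hb)) hj
    rw [Function.update_of_ne hja] at hj
    simp [hja, hj]
  calc _ ≤ ((Finset.univ.filter fun j => Odd (p j)).erase a).card := Finset.card_le_card hsub
    _ < _ := Finset.card_erase_lt_of_mem (by simp [ha])

/-- **Odd-support reduction**: a vector with some odd coordinate becomes, after an admissible re-lettering along `O`, a vector with
exactly one odd coordinate. OURS. [folklore] -/
theorem exists_relettering_single_odd (O : ValuationSubring K) :
    ∀ (s : ℕ) (z : Fin n → K) (_ : ∀ j, z j ∈ O) (_ : ∀ j, z j ≠ 0) (p : Fin n → ℤ)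
      (_ : (Finset.univ.filter fun j => Odd (p j)).card ≤ s) (_ : ∃ j, Odd (p j)),
      ∃ (z' : Fin n → K) (T : (Fin n → ℤ) → (Fin n → ℤ)), Relettering k O z z' T ∧
        ∃ a, Odd (T p a) ∧ ∀ j, j ≠ a → Even (T p j) := by
  classical
  intro s
  induction s with
  | zero =>
    intro z hzO hz0 p hs hodd
    obtain ⟨j, hj⟩ := hodd
    have : j ∈ (Finset.univ.filter fun j => Odd (p j)) := by simp [hj]
    exact absurd hs (not_le.mpr (Finset.card_pos.mpr ⟨j, this⟩))
  | succ s ih =>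
    intro z hzO hz0 p hs hodd
    obtain ⟨a, ha⟩ := hodd
    by_cases hone : ∀ j, j ≠ a → Even (p j)
    · exact ⟨z, id, relettering_refl O z hzO hz0, a, ha, hone⟩
    push Not at hone
    obtain ⟨b, hba, hb⟩ := hone
    rw [Int.not_even_iff_odd] at hb
    -- blow up the pair (a, b) of odd letters
    rcases relettering_step (k := k) O z hzO hz0 hba.symm with ⟨z₁, hR₁⟩ | ⟨z₁, hR₁⟩
    · -- pivot `a`
      have hlt := card_odd_update_lt p hba.symm ha hb
      have hodd₁ : ∃ j, Odd (Function.update p a (p a + p b) j) := ⟨b, by rw [Function.update_of_ne hba]; exact hb⟩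
      obtain ⟨z₂, T₂, hR₂, a', ha', hrest⟩ :=
        ih z₁ hR₁.1 hR₁.2.1 _ (Nat.lt_succ_iff.mp (lt_of_lt_of_le hlt hs)) hodd₁
      exact ⟨z₂, _, relettering_trans O hR₁ hR₂, a', ha', hrest⟩
    · -- pivot `b`
      have hlt := card_odd_update_lt p hba hb ha
      have hodd₁ : ∃ j, Odd (Function.update p b (p b + p a) j) := ⟨a, by rw [Function.update_of_ne hba.symm]; exact ha⟩
      obtain ⟨z₂, T₂, hR₂, a', ha', hrest⟩ :=
        ih z₁ hR₁.1 hR₁.2.1 _ (Nat.lt_succ_iff.mp (lt_of_lt_of_le hlt hs)) hodd₁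
      exact ⟨z₂, _, relettering_trans O hR₁ hR₂, a', ha', hrest⟩

end OddSupport

/-! ## §2 The Jacobian chart `∂/∂Z_a` -/

section Chart

variable {n : ℕ}

/-- `X_a · ∂_a (d · Z^s) = (s a) · (d · Z^s)` (Euler's relation in one variable, on a monomial). [folklore] -/
theorem X_mul_pderiv_monomial (a : Fin n) (s : Fin n →₀ ℕ) (d : k) :
    X a * pderiv a (monomial s d) = monomial s (d * (s a : k)) := by
  classical
  rw [pderiv_monomial]
  by_cases h : s a = 0
  · simp [h]
  · have h1 : 1 ≤ s a := Nat.one_le_iff_ne_zero.mpr h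
    have hle : Finsupp.single a 1 ≤ s := Finsupp.single_le_iff.mpr (by simpa using h1)
    rw [X, monomial_mul, one_mul, add_comm, tsub_add_cancel_of_le hle]

/-- Evaluation of a monomial at the letters: `(d · Z^s)(z) = d · ∏ z_j ^ s_j`. [folklore] -/
theorem aeval_monomial_eq (z : Fin n → K) (s : Fin n →₀ ℕ) (d : k) :
    aeval z (monomial s d) = algebraMap k K d * ∏ j, z j ^ s j := by
  rw [aeval_monomial, Finsupp.prod_fintype _ _ (fun i => by simp)]

/-- **The Jacobian chart.** Letters `z` in `O ∖ 0`, `t₁² = c₀ · z_a · U(z)` with `c₀ ≠ 0`, `v(U(z) − 1) < 1`, `v(z_a (∂U/∂Z_a)(z)) < 1`,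
`k(z, t₁) = K`, `trdeg_k K = n`: then `Concl O A₀ t` for every finitely generated `A₀ ≤ k[z]` and every `t ∈ k[z, t₁]` (the hypersurface
`T² − c₀ Z_a U` has the Jacobian unit `∂/∂Z_a` at `(z, t₁)`; (E2) `concl_of_jacobianUnit`). OURS. [cite: Matsumura1987, Thm. 30.3]
[folklore] -/
theorem concl_of_single_odd_chart (O : ValuationSubring K) (hk : ∀ c : k, algebraMap k K c ∈ O)
    (z : Fin n → K) (hzO : ∀ j, z j ∈ O) (t₁ : K) (ht₁O : t₁ ∈ O) (c₀ : k) (hc₀ : c₀ ≠ 0) (a : Fin n)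
    (U : MvPolynomial (Fin n) k) (hU1 : O.valuation (aeval z U - 1) < 1)
    (hUd : O.valuation (z a * aeval z (pderiv a U)) < 1)
    (ht₁ : t₁ ^ 2 = algebraMap k K c₀ * z a * aeval z U)
    (hgen : IntermediateField.adjoin k (Set.range (Fin.snoc z t₁ : Fin (n + 1) → K)) = ⊤) (htr : Algebra.trdeg k K = n)
    (A₀ : Subalgebra k K) (hA₀ : A₀.FG) (hA₀le : A₀ ≤ Algebra.adjoin k (Set.range z))
    (t : K) (ht : t ∈ Algebra.adjoin k (Set.range (Fin.snoc z t₁ : Fin (n + 1) → K))) :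
    SwitchingDichotomy.Words.Concl O A₀ t := by
  classical
  set zv : Fin (n + 1) → K := Fin.snoc z t₁ with hzv
  have hzv_cast : ∀ j : Fin n, zv j.castSucc = z j := fun j => by simp [hzv]
  have hzv_last : zv (Fin.last n) = t₁ := by simp [hzv]
  have hcomp : zv ∘ Fin.castSucc = z := funext hzv_cast
  have hzvO : ∀ j, zv j ∈ O := fun j => by
    refine Fin.lastCases ?_ (fun j => ?_) j
    · rw [hzv_last]; exact ht₁O
    · rw [hzv_cast]; exact hzO j
  -- the relation
  set G : MvPolynomial (Fin (n + 1)) k :=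
    X (Fin.last n) ^ 2 - C c₀ * X (Fin.castSucc a) * rename Fin.castSucc U with hGdef
  have hUv : aeval zv (rename Fin.castSucc U) = aeval z U := by rw [aeval_rename, hcomp]
  have hG : aeval zv G = 0 := by
    rw [hGdef, map_sub, map_pow, aeval_X, hzv_last, map_mul, map_mul, aeval_C, aeval_X, hzv_cast, hUv, ht₁, sub_self]
  -- the Jacobian unit `∂/∂Z_a`
  have hne : Fin.last n ≠ Fin.castSucc a := (Fin.castSucc_lt_last a).ne'
  have hD : pderiv (Fin.castSucc a) G =
      -(C c₀ * (rename Fin.castSucc U + X (Fin.castSucc a) * rename Fin.castSucc (pderiv a U))) := by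
    simp only [hGdef, map_sub, Derivation.leibniz, Derivation.leibniz_pow, pderiv_X_of_ne hne, pderiv_C, pderiv_X_self,
      pderiv_rename (Fin.castSucc_injective n), smul_zero, smul_eq_mul, mul_zero, add_zero, zero_sub, mul_one]
    ring
  have hev : aeval zv (pderiv (Fin.castSucc a) G) = -(algebraMap k K c₀ * (aeval z U + z a * aeval z (pderiv a U))) := by
    rw [hD, map_neg, map_mul, map_add, map_mul, aeval_C, aeval_X, hzv_cast, hUv, aeval_rename, hcomp]
  have hJ : ∃ j, O.valuation (aeval zv (pderiv j G)) = 1 := by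
    refine ⟨Fin.castSucc a, ?_⟩
    rw [hev, Valuation.map_neg, Valuation.map_mul]
    have hc : O.valuation (algebraMap k K c₀) = 1 := by
      apply le_antisymm ((O.valuation_le_one_iff _).mpr (hk c₀))
      have hinv : O.valuation (algebraMap k K c₀⁻¹) ≤ 1 := (O.valuation_le_one_iff _).mpr (hk _)
      have hc0K : algebraMap k K c₀ ≠ 0 := (map_ne_zero _).mpr hc₀
      have hprod : O.valuation (algebraMap k K c₀) * O.valuation (algebraMap k K c₀⁻¹) = 1 := by
        rw [← Valuation.map_mul, map_inv₀, mul_inv_cancel₀ hc0K, Valuation.map_one]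
      calc (1 : _) = O.valuation (algebraMap k K c₀) * O.valuation (algebraMap k K c₀⁻¹) := hprod.symm
        _ ≤ O.valuation (algebraMap k K c₀) * 1 := mul_le_mul_right hinv _
        _ = O.valuation (algebraMap k K c₀) := mul_one _
    have hsum : O.valuation (aeval z U + z a * aeval z (pderiv a U)) = 1 := by
      have e : aeval z U + z a * aeval z (pderiv a U) = 1 + ((aeval z U - 1) + z a * aeval z (pderiv a U)) := by ring
      rw [e]
      exact Valuation.map_one_add_of_lt _ (Valuation.map_add_lt _ hU1 hUd)
    rw [hc, hsum, one_mul]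
  -- the sandwich data
  have hzA : ∀ j : Fin n, z j ∈ Algebra.adjoin k (Set.range zv) := fun j => by
    rw [← hzv_cast j]; exact Algebra.subset_adjoin ⟨_, rfl⟩
  have hzle : Algebra.adjoin k (Set.range z) ≤ Algebra.adjoin k (Set.range zv) :=
    Algebra.adjoin_le (Set.range_subset_iff.mpr hzA)
  have hA₀L : A₀.toSubring ≤ locAtCentre (Algebra.adjoin k (Set.range zv)).toSubring O :=
    fun x hx => le_locAtCentre _ _ (hzle (hA₀le hx))
  have htL : t ∈ locAtCentre (Algebra.adjoin k (Set.range zv)).toSubring O := le_locAtCentre _ _ ht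
  exact SteerToricExitCriterion.concl_of_jacobianUnit O hk zv hzvO hgen htr G hG hJ A₀ hA₀ hA₀L t htL

end Chart

/-! ## §3 The general theorem -/

section Main

variable {n : ℕ}

/-- `ℕ`-exponents as `ℤ`-exponents. [folklore] -/
theorem prod_zpow_natCast (z : Fin n → K) (g : Fin n → ℕ) : (∏ j, z j ^ ((g j : ℤ))) = ∏ j, z j ^ g j :=
  Finset.prod_congr rfl fun j _ => zpow_natCast (z j) (g j)

/-- A Laurent monomial with non-negative exponents is an honest monomial. [folklore] -/
theorem prod_zpow_eq_prod_pow_toNat (z : Fin n → K) (f : Fin n → ℤ) (hf : ∀ j, 0 ≤ f j) :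
    (∏ j, z j ^ f j) = ∏ j, z j ^ (f j).toNat := by
  rw [← prod_zpow_natCast]
  exact Finset.prod_congr rfl fun j _ => by rw [Int.toNat_of_nonneg (hf j)]

/-- Honest monomials in the letters lie in `k[z]`. [folklore] -/
theorem prod_pow_mem_adjoin (z : Fin n → K) (g : Fin n → ℕ) : (∏ j, z j ^ g j) ∈ Algebra.adjoin k (Set.range z) :=
  prod_mem fun j _ => Subalgebra.pow_mem _ (Algebra.subset_adjoin (Set.mem_range_self j)) _

/-- Honest monomials in letters of `O` lie in `O`. [folklore] -/
theorem prod_pow_mem (O : ValuationSubring K) (z : Fin n → K) (hzO : ∀ j, z j ∈ O) (g : Fin n → ℕ) : (∏ j, z j ^ g j) ∈ O :=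
  prod_mem fun i _ => pow_mem (hzO i) (g i)

/-- The Laurent monomial of a unit vector is the letter. [folklore] -/
theorem prod_zpow_indicator (z : Fin n → K) (i : Fin n) : (∏ j, z j ^ (if j = i then (1 : ℤ) else 0)) = z i := by
  classical
  rw [Finset.prod_congr rfl fun j _ => show z j ^ (if j = i then (1 : ℤ) else 0) = if j = i then z j else 1 by
    split_ifs <;> simp, Finset.prod_ite_eq' Finset.univ i, if_pos (Finset.mem_univ i)]

/-- **TORIC EXIT AT A DOMINANT PRIMITIVE VERTEX, ALONG ANY VALUATION** (GENERAL; any characteristic, any number of letters and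
monomials). If `t² = Σ_{i ≤ m} c_i · y^{E_i}` with `c_0 ≠ 0`, letters `y_j ∈ O ∖ 0`, the vertex `E_0` having SOME ODD exponent and being
STRICTLY ν-DOMINANT along `O` (`O.valuation y^{E_i} < O.valuation y^{E_0}`, `i ≠ 0`), and `k(y, t) = K`, `trdeg_k K = n`, then
`Concl O k[y] t`: a regular finitely generated model through `k[y, t]` dominated by `O`, obtained by finitely many pair blow-ups decided
by `O` and one hypersurface chart. OURS. [cite: Teissier2014] [folklore] -/
theorem concl_of_dominant_monomial (O : ValuationSubring K) (hk : ∀ c : k, algebraMap k K c ∈ O)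
    {n m : ℕ} (y : Fin n → K) (hy0 : ∀ j, y j ≠ 0) (hyO : ∀ j, y j ∈ O) (t : K)
    (c : Fin (m + 1) → k) (hc0 : c 0 ≠ 0) (E : Fin (m + 1) → Fin n → ℕ) (hodd : ∃ j, Odd (E 0 j))
    (ht : t ^ 2 = ∑ i, algebraMap k K (c i) * ∏ j, y j ^ E i j)
    (hdom : ∀ i, i ≠ 0 → O.valuation (∏ j, y j ^ E i j) < O.valuation (∏ j, y j ^ E 0 j))
    (hgen : IntermediateField.adjoin k (insert t (Set.range y)) = ⊤) (htr : Algebra.trdeg k K = n) :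
    SwitchingDichotomy.Words.Concl O (Algebra.adjoin k (Set.range y)) t := by
  classical
  -- §3.1 the ratios `y^{E_{i+1} − E_0}` have value `< 1`
  set F : Fin m → Fin n → ℤ := fun i j => (E i.succ j : ℤ) - E 0 j with hF
  have hP0 : (∏ j, y j ^ E 0 j) ≠ 0 := Finset.prod_ne_zero_iff.mpr fun j _ => pow_ne_zero _ (hy0 j)
  have hratio : ∀ i : Fin m, (∏ j, y j ^ F i j) = (∏ j, y j ^ E i.succ j) / ∏ j, y j ^ E 0 j := fun i => by
    rw [eq_div_iff hP0, ← prod_zpow_natCast, ← prod_zpow_natCast, ← SteerToricConcl.prod_zpow_add y hy0]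
    exact Finset.prod_congr rfl fun j _ => by simp [hF]
  have hF1 : ∀ i : Fin m, O.valuation (∏ j, y j ^ F i j) < 1 := fun i => by
    rw [hratio, map_div₀]
    have hpos : 0 < O.valuation (∏ j, y j ^ E 0 j) := zero_lt_iff.mpr ((map_ne_zero _).mpr hP0)
    exact (div_lt_one₀ hpos).mpr (hdom i.succ (Fin.succ_ne_zero i))
  -- §3.2 Perron: the ratios become ℕ-monomials; then the odd support of the vertex becomes one letter
  obtain ⟨z₁, T₁, hR₁, hF₁⟩ := exists_relettering_nonneg_family (k := k) O m y hyO hy0 F hF1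
  set p₀ : Fin n → ℤ := fun j => (E 0 j : ℤ) with hp₀
  have hp₀nn : ∀ j, 0 ≤ p₀ j := fun j => by simp [hp₀]
  have hp₀odd : ∃ j, Odd (p₀ j) := by
    obtain ⟨j, hj⟩ := hodd; exact ⟨j, by simpa [hp₀] using (Int.odd_coe_nat _).mpr hj⟩
  obtain ⟨z₂, T₂, hR₂, a, ha, heven⟩ :=
    exists_relettering_single_odd (k := k) O _ z₁ hR₁.1 hR₁.2.1 (T₁ p₀) le_rfl (hR₁.2.2.2.2.2.2 _ hp₀odd)
  have hR : Relettering k O y z₂ (T₂ ∘ T₁) := relettering_trans O hR₁ hR₂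
  obtain ⟨hz₂O, hz₂0, hadj, hmono, -, hnn, -⟩ := hR
  set p : Fin n → ℤ := T₂ (T₁ p₀) with hp
  set g : Fin m → Fin n → ℤ := fun i => T₂ (T₁ (F i)) with hg
  have hpnn : ∀ j, 0 ≤ p j := hnn _ hp₀nn
  have hgnn : ∀ i j, 0 ≤ g i j := fun i => hR₂.2.2.2.2.2.1 _ (hF₁ i)
  have hp_eq : (∏ j, z₂ j ^ p j) = ∏ j, y j ^ E 0 j := by rw [hp, ← prod_zpow_natCast]; exact hmono p₀
  have hg_eq : ∀ i, (∏ j, z₂ j ^ g i j) = ∏ j, y j ^ F i j := fun i => hmono (F i)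
  -- §3.3 the square part: `p = 2q + δ_a`
  set q : Fin n → ℤ := fun j => p j / 2 with hq
  have hqnn : ∀ j, 0 ≤ q j := fun j => Int.ediv_nonneg (hpnn j) (by norm_num)
  have hpq : ∀ j, p j = 2 * q j + if j = a then 1 else 0 := fun j => by
    have hqj : q j = p j / 2 := rfl
    by_cases hja : j = a
    · subst hja
      rw [if_pos rfl, hqj]
      have h := Int.odd_iff.mp ha
      omega
    · rw [if_neg hja, add_zero, hqj]
      have h := Int.even_iff.mp (heven j hja)
      omega
  set w : K := ∏ j, z₂ j ^ q j with hw
  have hw0 : w ≠ 0 := Finset.prod_ne_zero_iff.mpr fun j _ => zpow_ne_zero _ (hz₂0 j)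
  have hwmem : w ∈ Algebra.adjoin k (Set.range z₂) := by
    rw [hw, prod_zpow_eq_prod_pow_toNat z₂ q hqnn]; exact prod_pow_mem_adjoin z₂ _
  have hwO : w ∈ O := by
    rw [hw, prod_zpow_eq_prod_pow_toNat z₂ q hqnn]; exact prod_pow_mem O z₂ hz₂O _
  have hP : (∏ j, y j ^ E 0 j) = z₂ a * w ^ 2 := by
    rw [← hp_eq, Finset.prod_congr rfl fun j _ => by rw [hpq j], SteerToricConcl.prod_zpow_add z₂ hz₂0,
      SteerToricConcl.prod_zpow_mul z₂ 2 q, prod_zpow_indicator, hw, mul_comm]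
    norm_cast
  -- §3.4 the unit cofactor `U = 1 + Σ (c_{i+1}/c_0) Z^{g_i}`
  set d : Fin m → k := fun i => c i.succ / c 0 with hd
  set s : Fin m → Fin n →₀ ℕ := fun i => Finsupp.equivFunOnFinite.symm fun j => (g i j).toNat with hs
  have hs_apply : ∀ i j, s i j = (g i j).toNat := fun i j => by simp [hs]
  set U : MvPolynomial (Fin n) k := 1 + ∑ i, monomial (s i) (d i) with hUdef
  have hr : ∀ i, (∏ j, z₂ j ^ s i j) = ∏ j, y j ^ F i j := fun i => by
    rw [← hg_eq i, prod_zpow_eq_prod_pow_toNat z₂ (g i) (hgnn i)]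
    exact Finset.prod_congr rfl fun j _ => by rw [hs_apply]
  have hmonoval : ∀ i, aeval z₂ (monomial (s i) (d i)) = algebraMap k K (d i) * ∏ j, y j ^ F i j := fun i => by
    rw [aeval_monomial_eq, hr]
  have hUval : aeval z₂ U = 1 + ∑ i, algebraMap k K (d i) * ∏ j, y j ^ F i j := by
    rw [hUdef, map_add, map_one, map_sum]
    exact congrArg _ (Finset.sum_congr rfl fun i _ => hmonoval i)
  have hdO : ∀ i, O.valuation (algebraMap k K (d i)) ≤ 1 := fun i => (O.valuation_le_one_iff _).mpr (hk _)
  have hU1 : O.valuation (aeval z₂ U - 1) < 1 := by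
    rw [hUval, add_sub_cancel_left]
    refine Valuation.map_sum_lt _ one_ne_zero fun i _ => ?_
    rw [Valuation.map_mul]
    calc O.valuation (algebraMap k K (d i)) * O.valuation (∏ j, y j ^ F i j)
        ≤ 1 * O.valuation (∏ j, y j ^ F i j) := mul_le_mul_left (hdO i) _
      _ < 1 := by rw [one_mul]; exact hF1 i
  have hUd : O.valuation (z₂ a * aeval z₂ (pderiv a U)) < 1 := by
    have e : z₂ a * aeval z₂ (pderiv a U) = ∑ i, aeval z₂ (X a * pderiv a (monomial (s i) (d i))) := by
      rw [hUdef, map_add, Derivation.map_one_eq_zero, zero_add, map_sum, map_sum, Finset.mul_sum]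
      exact Finset.sum_congr rfl fun i _ => by rw [map_mul, aeval_X]
    rw [e]
    refine Valuation.map_sum_lt _ one_ne_zero fun i _ => ?_
    rw [X_mul_pderiv_monomial, ← mul_comm (s i a : k) (d i), ← smul_eq_mul, ← smul_monomial, map_smul, Algebra.smul_def,
      hmonoval, Valuation.map_mul, Valuation.map_mul]
    have h1 : O.valuation (algebraMap k K (s i a : k)) ≤ 1 := (O.valuation_le_one_iff _).mpr (hk _)
    calc O.valuation (algebraMap k K (s i a : k)) * (O.valuation (algebraMap k K (d i)) * O.valuation (∏ j, y j ^ F i j))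
        ≤ 1 * (1 * O.valuation (∏ j, y j ^ F i j)) :=
          mul_le_mul' h1 (mul_le_mul_left (hdO i) _)
      _ < 1 := by rw [one_mul, one_mul]; exact hF1 i
  -- §3.5 the torsor equation in the new letters: `t₁² = c_0 · z_a · U(z)` with `t₁ = t / w`
  have hsumsplit : (∑ i, algebraMap k K (c i) * ∏ j, y j ^ E i j) =
      algebraMap k K (c 0) * (∏ j, y j ^ E 0 j) * aeval z₂ U := by
    rw [Fin.sum_univ_succ, hUval, mul_add, mul_one, Finset.mul_sum]
    congr 1
    refine Finset.sum_congr rfl fun i _ => ?_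
    rw [hratio i, hd, map_div₀]
    have hc0K : algebraMap k K (c 0) ≠ 0 := (map_ne_zero _).mpr hc0
    field_simp
  set t₁ : K := t / w with ht₁def
  have ht₁ : t₁ ^ 2 = algebraMap k K (c 0) * z₂ a * aeval z₂ U := by
    rw [ht₁def, div_pow, ht, hsumsplit, hP]
    field_simp
  have ht₁O : t₁ ∈ O := by
    have h2 : O.valuation (t₁ ^ 2) ≤ 1 := by
      rw [ht₁, Valuation.map_mul, Valuation.map_mul]
      have hU : O.valuation (aeval z₂ U) = 1 := by
        have e : aeval z₂ U = 1 + (aeval z₂ U - 1) := by ring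
        rw [e]; exact Valuation.map_one_add_of_lt _ hU1
      rw [hU, mul_one]
      exact mul_le_one' ((O.valuation_le_one_iff _).mpr (hk _)) ((O.valuation_le_one_iff _).mpr (hz₂O a))
    rw [← O.valuation_le_one_iff]
    rw [Valuation.map_pow] at h2
    exact (pow_le_one_iff_of_nonneg zero_le two_ne_zero).mp h2
  have htw : t = t₁ * w := by rw [ht₁def, div_mul_cancel₀ _ hw0]
  -- §3.6 field generation `k(z, t₁) = K` and the sandwich data
  set zv : Fin (n + 1) → K := Fin.snoc z₂ t₁ with hzv
  have hzv_cast : ∀ j : Fin n, zv j.castSucc = z₂ j := fun j => by simp [hzv]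
  have hzv_last : zv (Fin.last n) = t₁ := by simp [hzv]
  have hz₂F : ∀ j, z₂ j ∈ IntermediateField.adjoin k (Set.range zv) := fun j => by
    rw [← hzv_cast j]; exact IntermediateField.subset_adjoin _ _ ⟨_, rfl⟩
  have ht₁F : t₁ ∈ IntermediateField.adjoin k (Set.range zv) := by
    rw [← hzv_last]; exact IntermediateField.subset_adjoin _ _ ⟨_, rfl⟩
  have hz₂A : ∀ j, z₂ j ∈ Algebra.adjoin k (Set.range zv) := fun j => by
    rw [← hzv_cast j]; exact Algebra.subset_adjoin ⟨_, rfl⟩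
  have hAz : Algebra.adjoin k (Set.range z₂) ≤ Algebra.adjoin k (Set.range zv) :=
    Algebra.adjoin_le (Set.range_subset_iff.mpr hz₂A)
  have hwF : w ∈ IntermediateField.adjoin k (Set.range zv) :=
    IntermediateField.algebra_adjoin_le_adjoin k _ (hAz hwmem)
  have hgen' : IntermediateField.adjoin k (Set.range zv) = ⊤ := by
    apply le_antisymm le_top
    rw [← hgen]
    apply IntermediateField.adjoin_le_iff.mpr
    rintro x (rfl | ⟨j, rfl⟩)
    · rw [htw]; exact mul_mem ht₁F hwF
    · have hyj : y j ∈ IntermediateField.adjoin k (Set.range z₂) := by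
        rw [hadj]; exact IntermediateField.subset_adjoin _ _ ⟨j, rfl⟩
      exact (IntermediateField.adjoin_le_iff.mpr (Set.range_subset_iff.mpr hz₂F)) hyj
  -- the original letters are ℕ-monomials in `z₂`
  have hyA : ∀ i, y i ∈ Algebra.adjoin k (Set.range z₂) := fun i => by
    have e := hmono (fun j => if j = i then (1 : ℤ) else 0)
    rw [prod_zpow_indicator] at e
    rw [← e, prod_zpow_eq_prod_pow_toNat z₂ _ (hnn _ fun j => by split_ifs <;> norm_num)]
    exact prod_pow_mem_adjoin z₂ _
  have hA₀le : Algebra.adjoin k (Set.range y) ≤ Algebra.adjoin k (Set.range z₂) :=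
    Algebra.adjoin_le (Set.range_subset_iff.mpr hyA)
  have hA₀fg : (Algebra.adjoin k (Set.range y)).FG := by
    refine ⟨Finset.univ.image y, ?_⟩
    rw [Finset.coe_image, Finset.coe_univ, Set.image_univ]
  have htA : t ∈ Algebra.adjoin k (Set.range zv) := by
    rw [htw, ← hzv_last]
    exact mul_mem (Algebra.subset_adjoin ⟨_, rfl⟩) (hAz hwmem)
  exact concl_of_single_odd_chart O hk z₂ hz₂O t₁ ht₁O (c 0) hc0 a U hU1 hUd ht₁ hgen' htr _ hA₀fg hA₀le t htA

end Main

end Summit.ResolutionOfSingularities.ResolutionOfSingularities.Theorems.SteerToricVertexExit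

end
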